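import Literature.MathematicalPhysics.QuantumFieldTheory.OSLaplaceGeometry
import HarnessLib

/-!
# The Laplace–Fourier transform of Euclidean test functions: the raw transform and its algebra

Topic `Literature/MathematicalPhysics/QuantumFieldTheory`; second file of bookkeeping for the proof
of `OS1973_wightmanVectors` along Osterwalder–Schrader I (1973), §4.3. The Laplace test function of
`LaplaceTestTransform` at Euclidean points (`euclidUncurry`, `OSLaplaceGeometry`) is the cutoff
`χ_S` times the **raw transform**

  `rawLaplace d n h ξ = ∫ h(x) e^{2π ∑ₖ x⁰ₖ ξ⁰ₖ − 2πi ∑ₖ ⟪x⃗ₖ, ξ⃗ₖ⟫} dx`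

(OS I (4.20) without the restriction to the support of `W̃`; `laplaceTest_euclid_apply`), and the
OS manipulations of §4.3 are identities of raw transforms:

* `rawLaplace_append` — the transform of a tensor product `F ⊗ G` in appended variables is the
  product of the transforms of the blocks (Fubini, `integral_fin_append_mul`; OS I (4.23)–(4.24));
* `rawLaplace_osAdjoint` — the transform of the OS adjoint `ΘF*` is
  `ξ ↦ conj (F̃ (−ξ_{n−1}, …, −ξ₀))` (OS I (4.24), `f̄̃ₙ(qₙ, −q_{n−1}, …, −q₁)`; change of variables
  along the measure-preserving OS reflection `thetaRevShift 0`);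
* `rawLaplace_translate` — translating the test function multiplies the transform by the
  exponential of the constant configuration (a Fourier phase for spatial translations, a real
  factor `e^{2πt∑ξ⁰}` for time translations);

together with the support bookkeeping for the test functions `ΘF* ⊗ G` of the OS inner product:
compact support (`hasCompactSupport_appendMul`) and, for `F`, `G` supported in the positive
time-ordered regions, support in the increasing-time region `monoRegion`
(`tsupport_osAdjoint_appendMul_subset_monoRegion`).

## References

* K. Osterwalder, R. Schrader, *Axioms for Euclidean Green's functions*, Comm. Math. Phys. 31
  (1973) 83–112, §4.3 eqs. (4.20), (4.23)–(4.24). [OsterwalderSchraderCMP1973]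
-/

noncomputable section

open Set Filter Complex MeasureTheory
open _root_.Topology
open scoped SchwartzMap RealInnerProductSpace ComplexConjugate ContDiff
open Literature.MathematicalPhysics.QuantumLattice Literature.MathematicalPhysics.QuantumFieldTheory
open Literature.Analysis.FunctionSpaces Literature.Analysis.Distribution

namespace Literature.MathematicalPhysics.QuantumFieldTheory

variable {d n m : ℕ}

/-! ### The raw transform -/

variable (d n) in
/-- **The raw Laplace–Fourier transform** of a Euclidean test function at the momentum
configuration `ξ`: `∫ h(x) e^{expForm (euclidUncurry x) (flatten ξ)} dx
= ∫ h(x) e^{2π ∑ₖ x⁰ₖ ξ⁰ₖ − 2πi ∑ₖ ⟪x⃗ₖ, ξ⃗ₖ⟫} dx` (Osterwalder–Schrader I (1973), (4.20), the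
Laplace transform in the times and Fourier transform in space, without the restriction to
`{q⁰ ≥ 0}`). [cite: OsterwalderSchraderCMP1973, §4.3 eq. (4.20)] -/
def rawLaplace (h : (Fin n → SpaceTime d) → ℂ) (ξ : Fin n → SpaceTime d) : ℂ :=
  ∫ x, h x * exp (expForm (euclidUncurry d n x) (flattenCLE d n ξ))

/-- **The Laplace test function at Euclidean points is the cutoff times the raw transform**:
`laplaceTest S euclidUncurry h (flatten ξ) = χ_S(flatten ξ) · rawLaplace h ξ`. [folklore] -/
theorem laplaceTest_euclid_apply {S : Set (EuclideanSpace ℝ (Fin n × Fin (d + 1)))}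
    {h : (Fin n → SpaceTime d) → ℂ} (hh : ContDiff ℝ ∞ h) (hc : HasCompactSupport h)
    (hsupp : tsupport h ⊆ laplaceDomain S (euclidUncurry d n)) (ξ : Fin n → SpaceTime d) :
    laplaceTest S (euclidUncurry d n) volume h (flattenCLE d n ξ) =
      (coneCutoff S (flattenCLE d n ξ) : ℂ) * rawLaplace d n h ξ := by
  rw [laplaceTest_apply' hh hc hsupp, rawLaplace, ← integral_const_mul]
  refine integral_congr_ae (Eventually.of_forall fun x => ?_)
  simp only [laplaceKernelFun_apply]
  ring

/-- **Tensor products in appended variables have product transforms** (Osterwalder–Schrader I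
(1973), (4.23)–(4.24): the double integral splits). [cite: OsterwalderSchraderCMP1973, §4.3 eqs. (4.23)–(4.24)] -/
theorem rawLaplace_append (φ : (Fin n → SpaceTime d) → ℂ) (ψ : (Fin m → SpaceTime d) → ℂ)
    (ξ : Fin (n + m) → SpaceTime d) :
    rawLaplace d (n + m) (fun z => φ (fun i => z (Fin.castAdd m i)) * ψ (fun j => z (Fin.natAdd n j))) ξ =
      rawLaplace d n φ (fun i => ξ (Fin.castAdd m i)) *
        rawLaplace d m ψ (fun j => ξ (Fin.natAdd n j)) := by
  simp only [rawLaplace]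
  rw [← integral_fin_append_mul]
  refine integral_congr_ae (Eventually.of_forall fun z => ?_)
  dsimp only
  have hz : expForm (euclidUncurry d (n + m) z) (flattenCLE d (n + m) ξ) =
      expForm (euclidUncurry d n fun i => z (Fin.castAdd m i)) (flattenCLE d n fun i => ξ (Fin.castAdd m i)) +
        expForm (euclidUncurry d m fun j => z (Fin.natAdd n j)) (flattenCLE d m fun j => ξ (Fin.natAdd n j)) := by
    conv_lhs => rw [← Fin.append_castAdd_natAdd (f := z)]
    exact expForm_euclidUncurry_append _ _ ξ
  rw [hz, Complex.exp_add]
  ring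

/-- `thetaRevShift 0` is the OS reflection `x ↦ (θx_{n−1}, …, θx₀)`. [folklore] -/
theorem thetaRevShift_zero (x : Fin n → SpaceTime d) :
    thetaRevShift 0 x = fun k => timeReflection (d + 1) (x (Fin.rev k)) := by
  funext k
  simp [thetaRevShift]

/-- **The transform of the OS adjoint** `(ΘF*)(x) = conj F(θx_{n−1}, …, θx₀)`:
`(ΘF*)̃(ξ) = conj F̃(−ξ_{n−1}, …, −ξ₀)` (Osterwalder–Schrader I (1973), (4.24), the argument
`(qₙ, −q_{n−1}, …, −q₁)` of `f̄̃ₙ`; change of variables along the measure-preserving involution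
`thetaRevShift 0` and `expForm_euclidUncurry_thetaRev`). [cite: OsterwalderSchraderCMP1973, §4.3 eq. (4.24)] -/
theorem rawLaplace_osAdjoint [NeZero d] (F : (Fin n → SpaceTime d) → ℂ) (ξ : Fin n → SpaceTime d) :
    rawLaplace d n (fun x => conj (F fun k => timeReflection (d + 1) (x (Fin.rev k)))) ξ =
      conj (rawLaplace d n F (negRevConfig d n ξ)) := by
  simp only [rawLaplace]
  rw [← integral_conj, ← integral_comp_thetaRevShift 0
    (fun x => conj (F fun k => timeReflection (d + 1) (x (Fin.rev k))) *
      exp (expForm (euclidUncurry d n x) (flattenCLE d n ξ)))]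
  refine integral_congr_ae (Eventually.of_forall fun x => ?_)
  have h1 : (fun k => timeReflection (d + 1) (thetaRevShift 0 x (Fin.rev k))) = x := by
    funext k
    rw [thetaRevShift_zero]
    simp [timeReflection_timeReflection]
  dsimp only
  rw [h1, thetaRevShift_zero, expForm_euclidUncurry_thetaRev, map_mul, ← Complex.exp_conj]

/-- **Translating the test function multiplies the transform by an exponential**:
`(h(· − a))̃(ξ) = e^{expForm (a, …, a) ξ̃} h̃(ξ)`. [folklore] -/
theorem rawLaplace_translate (h : (Fin n → SpaceTime d) → ℂ) (a : SpaceTime d)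
    (ξ : Fin n → SpaceTime d) :
    rawLaplace d n (fun x => h fun k => x k - a) ξ =
      exp (expForm (euclidUncurry d n fun _ => a) (flattenCLE d n ξ)) * rawLaplace d n h ξ := by
  simp only [rawLaplace]
  rw [← integral_const_mul, ← integral_add_right_eq_self
    (fun x : Fin n → SpaceTime d => h (fun k => x k - a) *
      exp (expForm (euclidUncurry d n x) (flattenCLE d n ξ))) (fun _ => a)]
  refine integral_congr_ae (Eventually.of_forall fun y => ?_)
  have h1 : (fun k : Fin n => (y + fun _ : Fin n => a) k - a) = y := by funext k; simp
  have h2 : (y + fun _ : Fin n => a) = fun k => y k + a := rfl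
  dsimp only
  rw [h1, h2, expForm_euclidUncurry_add_const, Complex.exp_add]
  ring

/-- Spatial translations: the factor is the Fourier phase `e^{−2πi⟪ã, ξ̃⟫}`. [folklore] -/
theorem rawLaplace_translate_of_spatial {a : SpaceTime d} (ha : a 0 = 0)
    (h : (Fin n → SpaceTime d) → ℂ) (ξ : Fin n → SpaceTime d) :
    rawLaplace d n (fun x => h fun k => x k - a) ξ =
      exp (((-2 * Real.pi * ⟪flattenCLE d n (fun _ : Fin n => a), flattenCLE d n ξ⟫ : ℝ) : ℂ) * I) *
        rawLaplace d n h ξ := by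
  rw [rawLaplace_translate, expForm_euclidUncurry_const_of_spatial ha]

/-- Time translations: the factor is the real exponential `e^{2πt ∑ₖ ξ⁰ₖ}`. [folklore] -/
theorem rawLaplace_translate_single (t : ℝ) (h : (Fin n → SpaceTime d) → ℂ) (ξ : Fin n → SpaceTime d) :
    rawLaplace d n (fun x => h fun k => x k - EuclideanSpace.single (0 : Fin (d + 1)) t) ξ =
      exp ((2 * Real.pi * t * ∑ k, ξ k 0 : ℝ) : ℂ) * rawLaplace d n h ξ := by
  rw [rawLaplace_translate, expForm_euclidUncurry_const_single]

/-! ### Supports of the test functions of the OS inner product -/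

section Supports

variable {E : Type*} [TopologicalSpace E] [T2Space E]

omit [T2Space E] in
/-- `Fin.append` is jointly continuous. [folklore] -/
theorem continuous_finAppend :
    Continuous fun q : (Fin n → E) × (Fin m → E) => Fin.append q.1 q.2 := by
  refine continuous_pi fun i => ?_
  refine Fin.addCases (motive := fun i => Continuous fun q : (Fin n → E) × (Fin m → E) => Fin.append q.1 q.2 i)
    (fun j => ?_) (fun j => ?_) i
  · simp only [Fin.append_left]; exact (continuous_apply j).comp continuous_fst
  · simp only [Fin.append_right]; exact (continuous_apply j).comp continuous_snd

/-- **Compact support of a product in appended variables.** [folklore] -/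
theorem hasCompactSupport_appendMul {F : (Fin n → E) → ℂ} {G : (Fin m → E) → ℂ}
    (hF : HasCompactSupport F) (hG : HasCompactSupport G) :
    HasCompactSupport fun z : Fin (n + m) → E =>
      F (fun i => z (Fin.castAdd m i)) * G (fun j => z (Fin.natAdd n j)) := by
  refine HasCompactSupport.intro ((hF.prod hG).image continuous_finAppend) fun z hz => ?_
  by_contra hne
  have hF' : (fun i => z (Fin.castAdd m i)) ∈ tsupport F :=
    subset_tsupport _ (left_ne_zero_of_mul hne)
  have hG' : (fun j => z (Fin.natAdd n j)) ∈ tsupport G :=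
    subset_tsupport _ (right_ne_zero_of_mul hne)
  exact hz ⟨((fun i => z (Fin.castAdd m i)), (fun j => z (Fin.natAdd n j))), ⟨hF', hG'⟩,
    Fin.append_castAdd_natAdd⟩

omit [T2Space E] in
/-- The support of a product in appended variables is controlled by the supports of the factors.
[folklore] -/
theorem tsupport_appendMul_subset {F : (Fin n → E) → ℂ} {G : (Fin m → E) → ℂ} :
    tsupport (fun z : Fin (n + m) → E => F (fun i => z (Fin.castAdd m i)) * G (fun j => z (Fin.natAdd n j))) ⊆
      {z | (fun i => z (Fin.castAdd m i)) ∈ tsupport F ∧ (fun j => z (Fin.natAdd n j)) ∈ tsupport G} := by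
  refine closure_minimal (fun z hz => ?_) ?_
  · exact ⟨subset_tsupport _ (left_ne_zero_of_mul hz), subset_tsupport _ (right_ne_zero_of_mul hz)⟩
  · have h1 : Continuous fun z : Fin (n + m) → E => fun i => z (Fin.castAdd m i) :=
      continuous_pi fun i => continuous_apply _
    have h2 : Continuous fun z : Fin (n + m) → E => fun j => z (Fin.natAdd n j) :=
      continuous_pi fun j => continuous_apply _
    exact ((isClosed_tsupport _).preimage h1).inter ((isClosed_tsupport _).preimage h2)

/-- The support of `x ↦ conj F(θx_{n−1}, …, θx₀)` is controlled by the support of `F`. [folklore] -/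
theorem tsupport_osAdjointFun_subset [NeZero d] {F : (Fin n → SpaceTime d) → ℂ} :
    tsupport (fun x : Fin n → SpaceTime d => conj (F fun k => timeReflection (d + 1) (x (Fin.rev k)))) ⊆
      {x | (fun k => timeReflection (d + 1) (x (Fin.rev k))) ∈ tsupport F} := by
  refine closure_minimal (fun x hx => subset_tsupport _ ?_) ?_
  · intro h0
    exact hx (by simp [h0])
  · have hc : Continuous fun x : Fin n → SpaceTime d => fun k => timeReflection (d + 1) (x (Fin.rev k)) :=
      continuous_pi fun k => (timeReflection (d + 1)).continuous.comp (continuous_apply _)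
    exact (isClosed_tsupport _).preimage hc

/-- **The test function of an OS inner product has increasing times**: if `F` and `G` are
supported in the positive time-ordered regions, then `ΘF* ⊗ G` is supported in the region of
configurations with strictly increasing times (negative increasing times in the first block,
positive increasing times in the second). [folklore] -/
theorem tsupport_osAdjoint_appendMul_subset_monoRegion [NeZero d] {F : (Fin n → SpaceTime d) → ℂ}
    {G : (Fin m → SpaceTime d) → ℂ} (hF : tsupport F ⊆ timeOrderedRegion d n)
    (hG : tsupport G ⊆ timeOrderedRegion d m) :
    tsupport (fun z : Fin (n + m) → SpaceTime d =>
      conj (F fun k => timeReflection (d + 1) (z (Fin.castAdd m (Fin.rev k)))) *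
        G (fun j => z (Fin.natAdd n j))) ⊆ monoRegion d (n + m) := by
  intro z hz
  have h := tsupport_appendMul_subset
    (F := fun x : Fin n → SpaceTime d => conj (F fun k => timeReflection (d + 1) (x (Fin.rev k))))
    (G := G) hz
  have hx : (fun k => timeReflection (d + 1) (z (Fin.castAdd m (Fin.rev k)))) ∈ timeOrderedRegion d n :=
    hF (tsupport_osAdjointFun_subset h.1)
  have hy : (fun j => z (Fin.natAdd n j)) ∈ timeOrderedRegion d m := hG h.2
  -- the times of the appended configuration
  have ht1 : ∀ a : Fin n, z (Fin.castAdd m a) 0 = -((fun k => timeReflection (d + 1)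
      (z (Fin.castAdd m (Fin.rev k)))) (Fin.rev a) 0) := fun a => by
    simp [timeReflection_apply]
  intro i j hij
  dsimp only
  induction i using Fin.addCases with
  | left a =>
    induction j using Fin.addCases with
    | left b =>
      have hab : a < b := by
        rw [Fin.lt_def] at hij ⊢; simpa using hij
      rw [ht1 a, ht1 b, neg_lt_neg_iff]
      exact hx.2 (Fin.rev_lt_rev.2 hab)
    | right b =>
      have h1 : z (Fin.castAdd m a) 0 < 0 := by
        rw [ht1 a, neg_lt_zero]
        exact hx.1 _
      exact h1.trans (hy.1 b)
  | right a =>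
    induction j using Fin.addCases with
    | left b =>
      exfalso
      rw [Fin.lt_def] at hij
      simp only [Fin.val_natAdd, Fin.val_castAdd] at hij
      omega
    | right b =>
      have hab : a < b := by
        rw [Fin.lt_def] at hij ⊢
        simp only [Fin.val_natAdd] at hij
        omega
      exact hy.2 hab

end Supports

end Literature.MathematicalPhysics.QuantumFieldTheory
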